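import Literature.Geometry.Riemannian.HeatKernelSubsolution
import Literature.Geometry.Riemannian.HeatGradientSubsolution
import HarnessLib

/-!
# The interior gradient estimate `(t − s)|∇u|²(x, t) + u²(x, t) ≤ ∫ u(·, s)² dν_{x,t;s}` for the
# heat equation coupled with a Ricci flow (Bamler 2020a, proof of Thm. 7.1, (7.4)–(7.5))

R. Bamler, *Entropy and heat kernel bounds on a Ricci flow background*, arXiv:2008.07093 (2020a),
§7, proof of Thm. 7.1: for a solution `u` of the heat equation `□u = (∂ₜ − Δ_{g_t})u = 0` coupled
with a Ricci flow on a closed manifold and a fixed initial time `s`, the function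
`v := (t − s)|∇u|² + u²` satisfies

  `□v = |∇u|² − 2(t − s)|∇²u|² − 2|∇u|² ≤ 0`,

so by the domination of sub-solutions by the conjugate heat kernel measures
`dν_{x,t;s} = K(x,t;·,s) dg_s`

  `(t − s)|∇u|²(x, t) + u²(x, t) = v(x, t) ≤ ∫ v(·, s) dν_{x,t;s} = ∫ u(·, s)² dν_{x,t;s}`

(displays (7.4)–(7.5), there with `s = ½`, `t ∈ [½, 1]`). This is the classical Bernstein-type
interior gradient estimate for the heat equation along a Ricci flow.

This file proves it, `mul_gradSq_add_sq_le_integral_sq_heatKernelMeasure`, for a Ricci flow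
`hflow = (h, cov)` on `[a, T]` of a `C^∞` family of Riemannian metrics on a closed connected
manifold `M` (modelled on `ℝᵐ`), `a < s < t ≤ T`, a smooth solution `u` of `∂ᵣu = Δ_{h(r)}u` on
`M × [s, t]` (one-sided time derivatives at the end points), and the tree's heat kernel measures
`ν_{x,t;s} = heatKernelMeasure hh hR t x s` (`HeatKernelMeasures.lean`). Ingredients: the
Bochner inequality `∂ᵣ|∇u|² ≤ Δ|∇u|²` under the flow (`derivWithin_gradSq_le_of_heat_ricciFlow`,
`HeatGradientSubsolution.lean`), `Δ(u²) = 2|∇u|² + 2uΔu` (`dalembertian_real_comp`), and the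
domination of sub-solutions by the heat kernel measures
(`integral_heatKernelMeasure_anti_of_subsolution`, `HeatKernelSubsolution.lean`, with
`ν_{x,t;t} = δ_x`).

Everything is proved; no definitions, no named facts. What is NOT here: the rest of the proof of
Bamler's Thm. 7.1 (the bound `|∇ₓK|(x,t;y,s) ≤ C (t − s)^{-1/2} K^{…}` obtained from (7.5) by the
`L²`/`L^∞` heat kernel bounds), super Ricci flows, non-compact `M`, solutions of lower
regularity.

## References

* R. H. Bamler, *Entropy and heat kernel bounds on a Ricci flow background*, arXiv:2008.07093
  (2020), §7, proof of Thm. 7.1, displays (7.4)–(7.5). [Bamler2020Entropy]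
* H.-J. Hein, A. Naber, *New logarithmic Sobolev inequalities and an ε-regularity theorem for the
  Ricci flow*, Comm. Pure Appl. Math. 67 (2014), 1543–1561, §3.1. [HeinNaber2014]
-/

noncomputable section

open Bundle Set Function Filter Manifold MeasureTheory Measure TopologicalSpace
open scoped Manifold ContDiff Topology ENNReal NNReal

namespace Literature.Geometry.Riemannian

open Lorentzian Lorentzian.PseudoRiemannianMetric

section InteriorGradient

variable {m : ℕ} {H : Type*} [TopologicalSpace H]
  {I : ModelWithCorners ℝ (EuclideanSpace ℝ (Fin m)) H} [I.Boundaryless]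
  {M : Type*} [TopologicalSpace M] [ChartedSpace H M] [IsManifold I ∞ M]
  [T2Space M] [CompactSpace M] [SecondCountableTopology M] [MeasurableSpace M] [BorelSpace M]
  [PreconnectedSpace M]
  {h : ℝ → PseudoRiemannianMetric I ∞ (EuclideanSpace ℝ (Fin m)) (TangentSpace I : M → Type _)}
  {cov : ℝ → CovariantDerivative I (EuclideanSpace ℝ (Fin m)) (TangentSpace I : M → Type _)}
  {a T : ℝ}

omit [I.Boundaryless] [T2Space M] [CompactSpace M] [SecondCountableTopology M] [MeasurableSpace M]
  [BorelSpace M] [PreconnectedSpace M] in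
/-- **The Laplacian of a square**: `Δ_g(f²)(x) = 2|∇f|²_g(x) + 2 f(x) Δ_g f(x)` for `f` of class
`C²` at `x` (the chain rule `Δ(ζ ∘ f) = ζ''(f)|∇f|² + ζ'(f)Δf`, `dalembertian_real_comp`, with
`ζ(v) = v²`). [folklore] -/
private theorem laplaceBeltrami_fun_sq'
    (g : PseudoRiemannianMetric I ∞ (EuclideanSpace ℝ (Fin m)) (TangentSpace I : M → Type _))
    {f : M → ℝ} {x : M} (hf : ContMDiffAt I 𝓘(ℝ, ℝ) 2 f x) :
    g.laplaceBeltrami (fun y ↦ f y ^ 2) x = 2 * g.gradSq f x + 2 * f x * g.laplaceBeltrami f x := by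
  haveI := g.hasLeviCivita
  have hζ : ContDiffAt ℝ 2 (fun v : ℝ ↦ v ^ 2) (f x) := contDiffAt_id.pow 2
  have h1 : deriv (fun v : ℝ ↦ v ^ 2) = fun v ↦ 2 * v := by
    funext v
    simp
  have h2 : deriv (deriv (fun v : ℝ ↦ v ^ 2)) (f x) = 2 := by
    rw [h1, ((hasDerivAt_id' (f x)).const_mul (2 : ℝ)).deriv, mul_one]
  rw [laplaceBeltrami_eq_dalembertian, laplaceBeltrami_eq_dalembertian,
    show (fun y ↦ f y ^ 2) = (fun v : ℝ ↦ v ^ 2) ∘ f from rfl, g.dalembertian_real_comp hf hζ, h2,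
    h1]
  simp only [PseudoRiemannianMetric.gradSq]

/-- **Bamler's interior gradient estimate for the heat equation coupled with a Ricci flow**
(Bamler 2020a, §7, proof of Thm. 7.1, displays (7.4)–(7.5)): for a Ricci flow `(h, cov)` on
`[a, T]` of a smooth family of Riemannian metrics on a closed connected manifold, `a < s < t ≤ T`,
a smooth solution `u` of the heat equation `∂ᵣu = Δ_{h(r)}u` on `M × [s, t]` (one-sided time
derivatives at the end points) and `x ∈ M`,

  `(t − s) |∇u(t)|²_{h(t)}(x) + u(t, x)² ≤ ∫ u(s, y)² dν_{x,t;s}(y)`.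

Proof: `v(r, y) = (r − s)|∇u(r)|²_{h(r)}(y) + u(r, y)²` is a smooth sub-solution of the heat
equation on `M × [s, t]`: `∂ᵣv = |∇u|² + (r − s)∂ᵣ|∇u|² + 2u Δu ≤ |∇u|² + (r − s)Δ|∇u|² + 2uΔu`
(`derivWithin_gradSq_le_of_heat_ricciFlow`), while
`Δv = (r − s)Δ|∇u|² + 2|∇u|² + 2uΔu` (`Δ(u²) = 2|∇u|² + 2uΔu`), so `∂ᵣv ≤ Δv − |∇u|² ≤ Δv`
(`|∇u|² ≥ 0` for a Riemannian metric); hence `v(x, t) ≤ ∫ v(s) dν_{x,t;s} = ∫ u(s)² dν_{x,t;s}`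
(`integral_heatKernelMeasure_anti_of_subsolution`, `ν_{x,t;t} = δ_x`).
[cite: Bamler2020Entropy, §7.2, proof of Thm. 7.1, (7.4)–(7.5)] -/
theorem mul_gradSq_add_sq_le_integral_sq_heatKernelMeasure (hflow : IsRicciFlow h cov (Icc a T))
    (hh : IsContMDiffFamilyOn ∞ h univ) (hR : ∀ r, (h r).IsRiemannian) {s t : ℝ} (has : a < s)
    (hst : s < t) (htT : t ≤ T) {u : ℝ → M → ℝ}
    (hu : ContMDiffOn (I.prod 𝓘(ℝ, ℝ)) 𝓘(ℝ, ℝ) ∞ (fun p : M × ℝ ↦ u p.2 p.1) (univ ×ˢ Icc s t))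
    (hueq : ∀ r ∈ Icc s t, ∀ y : M,
      HasDerivWithinAt (fun r' ↦ u r' y) ((h r).laplaceBeltrami (u r) y) (Icc s t) r)
    (x : M) :
    (t - s) * (h t).gradSq (u t) x + u t x ^ 2 ≤
      ∫ y, u s y ^ 2 ∂(heatKernelMeasure hh hR t x s) := by
  have h2le : (2 : ℕ∞ω) ≤ ((⊤ : ℕ∞) : ℕ∞ω) := WithTop.coe_le_coe.mpr le_top
  have hU : UniqueDiffOn ℝ (Icc s t) := uniqueDiffOn_Icc hst
  -- the flow restricted to `[s, t]`
  have hflow' : IsRicciFlow h cov (Icc s t) := hflow.mono (Icc_subset_Icc has.le htT)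
  -- `|∇u(r)|²_{h(r)}(y)` is smooth on `M × [s, t]` and a sub-solution of the heat equation
  have hW : ContMDiffOn (I.prod 𝓘(ℝ, ℝ)) 𝓘(ℝ, ℝ) ∞
      (fun p : M × ℝ ↦ (h p.2).gradSq (u p.2) p.1) (univ ×ˢ Icc s t) :=
    hflow'.smooth.contMDiffOn_gradSq hU hu
  have hWsub : ∀ r ∈ Icc s t, ∀ y : M,
      derivWithin (fun r' ↦ (h r').gradSq (u r') y) (Icc s t) r ≤
        (h r).laplaceBeltrami ((h r).gradSq (u r)) y := fun r hr y ↦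
    derivWithin_gradSq_le_of_heat_ricciFlow hst hflow' (fun r' _ ↦ hR r') hu hueq hr y
  -- (1) `v = (r − s)|∇u|² + u²` is smooth on `M × [s, t]`
  have hvsmooth : ContMDiffOn (I.prod 𝓘(ℝ, ℝ)) 𝓘(ℝ, ℝ) ∞
      (fun p : M × ℝ ↦ (p.2 - s) * (h p.2).gradSq (u p.2) p.1 + u p.2 p.1 ^ 2)
      (univ ×ˢ Icc s t) := by
    have hl : ContMDiffOn (I.prod 𝓘(ℝ, ℝ)) 𝓘(ℝ, ℝ) ∞ (fun p : M × ℝ ↦ p.2 - s)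
        (univ ×ˢ Icc s t) := (contMDiff_snd.sub contMDiff_const).contMDiffOn
    exact (hl.mul hW).add (hu.pow 2)
  -- (2) `v` is a sub-solution: `∂ᵣv ≤ Δv − |∇u|² ≤ Δv`
  have hvsub : ∀ r ∈ Icc s t, ∀ y : M,
      derivWithin (fun r' ↦ (r' - s) * (h r').gradSq (u r') y + u r' y ^ 2) (Icc s t) r ≤
        (h r).laplaceBeltrami (fun y ↦ (r - s) * (h r).gradSq (u r) y + u r y ^ 2) y := by
    intro r hr y
    have hur : ContMDiffAt I 𝓘(ℝ, ℝ) 2 (u r) y :=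
      ((contMDiff_slice_of_contMDiffOn hu hr).of_le h2le).contMDiffAt
    have hWr : ContMDiffAt I 𝓘(ℝ, ℝ) 2 ((h r).gradSq (u r)) y :=
      ((contMDiff_slice_of_contMDiffOn (u := fun r' y ↦ (h r').gradSq (u r') y) hW hr).of_le
        h2le).contMDiffAt
    -- the time derivative
    have hWd : HasDerivWithinAt (fun r' ↦ (h r').gradSq (u r') y)
        (derivWithin (fun r' ↦ (h r').gradSq (u r') y) (Icc s t) r) (Icc s t) r :=
      hasDerivWithinAt_time_of_contMDiffOn (by simp) (u := fun r' y ↦ (h r').gradSq (u r') y)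
        hW y hr
    have hlin : HasDerivWithinAt (fun r' : ℝ ↦ r' - s) 1 (Icc s t) r :=
      (hasDerivWithinAt_id r _).sub_const s
    have hd := (hlin.fun_mul hWd).fun_add ((hueq r hr y).fun_pow 2)
    rw [hd.derivWithin (hU r hr)]
    -- the Laplacian
    have hΔ : (h r).laplaceBeltrami (fun y ↦ (r - s) * (h r).gradSq (u r) y + u r y ^ 2) y =
        (r - s) * (h r).laplaceBeltrami ((h r).gradSq (u r)) y +
          (2 * (h r).gradSq (u r) y + 2 * u r y * (h r).laplaceBeltrami (u r) y) := by
      rw [laplaceBeltrami_fun_add (h r) (f₁ := fun y ↦ (r - s) * (h r).gradSq (u r) y)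
          (f₂ := fun y ↦ u r y ^ 2) (contMDiffAt_const.mul hWr) (hur.pow 2),
        laplaceBeltrami_const_mul (h r) hWr, laplaceBeltrami_fun_sq' (h r) hur]
    rw [hΔ]
    -- `(r − s) ∂ᵣ|∇u|² ≤ (r − s) Δ|∇u|²` and `|∇u|² ≥ 0`
    have hg := mul_le_mul_of_nonneg_left (hWsub r hr y) (sub_nonneg.2 hr.1)
    have h0 : 0 ≤ (h r).gradSq (u r) y := (h r).innerDual_self_nonneg (hR r) y _
    push_cast
    nlinarith [hg, h0]
  -- (3) domination of the sub-solution `v` by the heat kernel measures: `v(x,t) ≤ ∫ v(s) dν`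
  have key := integral_heatKernelMeasure_anti_of_subsolution hflow hh hR ⟨has.trans hst, htT⟩ x
    has hst le_rfl (w := fun r' y ↦ (r' - s) * (h r').gradSq (u r') y + u r' y ^ 2) hvsmooth
    hvsub
  rw [heatKernelMeasure_self, integral_dirac] at key
  simpa only [sub_self, zero_mul, zero_add] using key

end InteriorGradient

end Literature.Geometry.Riemannian
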